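import Summits.BirchSwinnertonDyer.BirchSwinnertonDyer.Theorems.CMKolyvaginAtInertTwoLagrangianTransversalLayeredLemmas
import HarnessLib

/-!
# Route `CMKolyvaginAtInertTwo`, crux `CMKolyvaginExactAtInertTwo` (stmt-BirchSwinnertonDyer-24277):
# LEMMAS FOR THE THREADING LEMMA (T5′, KERNEL-STATUS §13.5; MEMO-T5prime-threading §7)

Seat `bsd-line-cmk2-p1` g14 (cell `bsd-print-cf2`); helper (`--supports stmt-BirchSwinnertonDyer-24277`).
THEOREMS ONLY: no definition, no named fact, no `sorry`; no item is closed; BSD is not proved by this.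
Pure finite-abelian-group algebra: the quotient-by-a-line bookkeeping used by the induction proving the
threading lemma (sequel `…ThreadingAtTwo`): for an abelian group `C`, a subgroup `N` and the quotient
map `mk : C → C/N`,

* `card_map_mk_mul_card` — `#(H.map mk) · #N = #H` when `N ≤ H`; `card_map_mk_of_disjoint` —
  `#(H.map mk) = #H` when `N ∩ H = 0`;
* `map_mk_inf_eq_of_le` — `mk(P) ∩ mk(Q) = mk(P ∩ Q)` when `N ≤ P` (modular law);
* `map_comap_inf_eq` — `mk(mk⁻¹(Ȳ) ∩ P) = Ȳ ∩ mk(P)`; `map_comap_inf_inf_eq` — the same with a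
  complement `K` of `N` inserted (`mk(mk⁻¹(Ȳ) ∩ K ∩ P) = Ȳ ∩ mk(P)` when `N ≤ P`);
* `disjoint_zmultiples_of_not_mem` — a line `⟨v⟩` of prime order meets `H ∌ v` trivially;
  `exists_isCompl_zmultiples_of_prime` — in an elementary abelian `p`-group every line has a
  complement (a maximal subgroup missing `v`).

References: [Hungerford1974] Ch. II §2 (finite abelian groups); folklore linear algebra over `𝔽_p`.
-/

-- single-conjunct summit: `Summit.BirchSwinnertonDyer.BirchSwinnertonDyer.…` repeats the name by design
set_option linter.dupNamespace false
set_option autoImplicit false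

noncomputable section

open AddSubgroup

namespace Summit.BirchSwinnertonDyer.BirchSwinnertonDyer.Theorems.KolyvaginLiftGroupsTwo

universe u

section Threading

variable {C : Type u} [AddCommGroup C]

/-- `#(H.map mk) · #N = #H` for `N ≤ H` (the quotient map restricted to `H` has kernel `N`).
[folklore] -/
theorem card_map_mk_mul_card [Finite C] {N H : AddSubgroup C} (h : N ≤ H) :
    Nat.card (H.map (QuotientAddGroup.mk' N)) * Nat.card N = Nat.card H := by
  set ψ : H →+ C ⧸ N := (QuotientAddGroup.mk' N).comp H.subtype with hψ_def
  have hrange : ψ.range = H.map (QuotientAddGroup.mk' N) := by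
    rw [hψ_def, AddMonoidHom.range_comp, AddSubgroup.range_subtype]
  have hker : Nat.card ψ.ker = Nat.card N := by
    have h1 : ψ.ker.map H.subtype = N := by
      ext t
      simp only [AddSubgroup.mem_map, AddMonoidHom.mem_ker, hψ_def, AddMonoidHom.comp_apply,
        AddSubgroup.coe_subtype, QuotientAddGroup.mk'_apply, QuotientAddGroup.eq_zero_iff]
      constructor
      · rintro ⟨y, hy, rfl⟩; exact hy
      · intro ht; exact ⟨⟨t, h ht⟩, ht, rfl⟩
    have h2 := Nat.card_congr (AddSubgroup.equivMapOfInjective ψ.ker H.subtype H.subtype_injective).toEquiv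
    rw [h1] at h2
    exact h2
  rw [← hrange, ← hker, mul_comm]
  exact (card_eq_card_ker_mul_card_range ψ).symm

/-- `#(H.map mk) = #H` when `N ∩ H = 0` (the quotient map is injective on `H`). [folklore] -/
theorem card_map_mk_of_disjoint {N H : AddSubgroup C} (h : Disjoint N H) :
    Nat.card (H.map (QuotientAddGroup.mk' N)) = Nat.card H := by
  have hinj : Function.Injective ((QuotientAddGroup.mk' N).comp H.subtype) := by
    rw [injective_iff_map_eq_zero]
    intro a ha
    rw [AddMonoidHom.comp_apply, AddSubgroup.coe_subtype, QuotientAddGroup.mk'_apply,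
      QuotientAddGroup.eq_zero_iff] at ha
    exact Subtype.ext ((AddSubgroup.disjoint_def.mp h) ha a.2)
  have hrange : ((QuotientAddGroup.mk' N).comp H.subtype).range = H.map (QuotientAddGroup.mk' N) := by
    rw [AddMonoidHom.range_comp, AddSubgroup.range_subtype]
  rw [← hrange]
  exact (Nat.card_congr (AddMonoidHom.ofInjective hinj).toEquiv).symm

/-- **Modular law in the quotient**: `mk(P) ∩ mk(Q) = mk(P ∩ Q)` when `N ≤ P`. [folklore] -/
theorem map_mk_inf_eq_of_le {N P Q : AddSubgroup C} (h : N ≤ P) :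
    P.map (QuotientAddGroup.mk' N) ⊓ Q.map (QuotientAddGroup.mk' N) =
      (P ⊓ Q).map (QuotientAddGroup.mk' N) := by
  refine le_antisymm ?_ (le_inf (AddSubgroup.map_mono inf_le_left)
    (AddSubgroup.map_mono inf_le_right))
  rintro z ⟨⟨a, ha, rfl⟩, ⟨b, hb, hab⟩⟩
  -- `b - a ∈ N ≤ P`, so `b ∈ P ∩ Q`
  have hba : b - a ∈ N := by
    rw [← QuotientAddGroup.eq_iff_sub_mem]
    exact hab
  refine ⟨b, AddSubgroup.mem_inf.mpr ⟨?_, hb⟩, hab⟩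
  have : b = (b - a) + a := by abel
  rw [this]
  exact P.add_mem (h hba) ha

/-- `mk(mk⁻¹(Ȳ) ∩ P) = Ȳ ∩ mk(P)`. [folklore] -/
theorem map_comap_inf_eq {N P : AddSubgroup C} (Ybar : AddSubgroup (C ⧸ N)) :
    (Ybar.comap (QuotientAddGroup.mk' N) ⊓ P).map (QuotientAddGroup.mk' N) =
      Ybar ⊓ P.map (QuotientAddGroup.mk' N) := by
  refine le_antisymm ?_ ?_
  · rintro z ⟨q, hq, rfl⟩
    obtain ⟨hqY, hqP⟩ := AddSubgroup.mem_inf.mp hq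
    exact AddSubgroup.mem_inf.mpr ⟨AddSubgroup.mem_comap.mp hqY, ⟨q, hqP, rfl⟩⟩
  · rintro z ⟨hzY, ⟨q, hqP, rfl⟩⟩
    exact ⟨q, AddSubgroup.mem_inf.mpr ⟨AddSubgroup.mem_comap.mpr hzY, hqP⟩, rfl⟩

/-- With a complement `K` of `N` (`N ⊔ K = ⊤`) and `N ≤ P`: `mk(mk⁻¹(Ȳ) ∩ K ∩ P) = Ȳ ∩ mk(P)`.
[folklore] -/
theorem map_comap_inf_inf_eq {N K P : AddSubgroup C} (hNK : Codisjoint N K) (h : N ≤ P)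
    (Ybar : AddSubgroup (C ⧸ N)) :
    (Ybar.comap (QuotientAddGroup.mk' N) ⊓ K ⊓ P).map (QuotientAddGroup.mk' N) =
      Ybar ⊓ P.map (QuotientAddGroup.mk' N) := by
  refine le_antisymm ?_ ?_
  · rintro z ⟨q, hq, rfl⟩
    obtain ⟨hq1, hqP⟩ := AddSubgroup.mem_inf.mp hq
    obtain ⟨hqY, -⟩ := AddSubgroup.mem_inf.mp hq1
    exact AddSubgroup.mem_inf.mpr ⟨AddSubgroup.mem_comap.mp hqY, ⟨q, hqP, rfl⟩⟩
  · rintro z ⟨hzY, ⟨q, hqP, rfl⟩⟩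
    -- decompose `q = n + y`, `n ∈ N`, `y ∈ K`
    have hq : q ∈ N ⊔ K := by rw [hNK.eq_top]; exact AddSubgroup.mem_top q
    obtain ⟨n, hn, y, hy, rfl⟩ := AddSubgroup.mem_sup.mp hq
    have hn0 : (QuotientAddGroup.mk' N) n = 0 := by
      rw [QuotientAddGroup.mk'_apply, QuotientAddGroup.eq_zero_iff]; exact hn
    have hmk : (QuotientAddGroup.mk' N) (n + y) = (QuotientAddGroup.mk' N) y := by
      rw [map_add, hn0, zero_add]
    refine ⟨y, AddSubgroup.mem_inf.mpr ⟨AddSubgroup.mem_inf.mpr ⟨?_, hy⟩, ?_⟩, hmk.symm⟩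
    · rw [AddSubgroup.mem_comap, ← hmk]; exact hzY
    · have : y = (n + y) - n := by abel
      rw [this]; exact P.sub_mem hqP (h hn)

/-- A line of prime order meets a subgroup missing its generator trivially. [folklore] -/
theorem disjoint_zmultiples_of_not_mem [Finite C] {p : ℕ} (hp : p.Prime) {v : C} (hv : p • v = 0)
    {H : AddSubgroup C} (hvH : v ∉ H) : Disjoint (zmultiples v) H := by
  haveI : Fact p.Prime := ⟨hp⟩
  have hv0 : v ≠ 0 := fun h ↦ hvH (h ▸ H.zero_mem)
  rw [AddSubgroup.disjoint_def]
  intro w hw hwH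
  by_contra hw0
  have hordv : addOrderOf v = p := addOrderOf_eq_prime hv hv0
  have hpw : p • w = 0 := by
    obtain ⟨c, rfl⟩ := AddSubgroup.mem_zmultiples_iff.mp hw
    rw [smul_comm, hv, zsmul_zero]
  have hordw : addOrderOf w = p := addOrderOf_eq_prime hpw hw0
  have heq : zmultiples w = zmultiples v := by
    refine AddSubgroup.eq_of_le_of_card_ge (AddSubgroup.zmultiples_le_of_mem hw) ?_
    rw [Nat.card_zmultiples, Nat.card_zmultiples, hordv, hordw]
  have : v ∈ zmultiples w := by rw [heq]; exact AddSubgroup.mem_zmultiples v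
  exact hvH ((AddSubgroup.zmultiples_le_of_mem hwH) this)

/-- **Every line of an elementary abelian `p`-group has a complement** (a maximal subgroup not
containing the generator). [folklore] -/
theorem exists_isCompl_zmultiples_of_prime [Finite C] {p : ℕ} (hp : p.Prime)
    (hCp : ∀ c : C, p • c = 0) (v : C) : ∃ K : AddSubgroup C, IsCompl (zmultiples v) K := by
  classical
  by_cases hv0 : v = 0
  · refine ⟨⊤, ?_⟩
    rw [hv0, AddSubgroup.zmultiples_zero_eq_bot]
    exact isCompl_bot_top
  -- a maximal subgroup not containing `v`
  haveI : Finite (AddSubgroup C) := inferInstance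
  obtain ⟨K, ⟨hKv, hKmax⟩⟩ : ∃ K : AddSubgroup C, v ∉ K ∧ ∀ K' : AddSubgroup C, v ∉ K' → K ≤ K' → K' = K := by
    obtain ⟨K, -, hK⟩ := Finite.exists_le_maximal (p := fun K : AddSubgroup C ↦ v ∉ K) (a := ⊥)
      (show v ∉ (⊥ : AddSubgroup C) by rw [AddSubgroup.mem_bot]; exact hv0)
    exact ⟨K, hK.prop, fun K' hK' hle ↦ hK.eq_of_ge hK' hle⟩
  refine ⟨K, isCompl_iff.mpr ⟨disjoint_zmultiples_of_not_mem hp (hCp v) hKv, ?_⟩⟩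
  rw [codisjoint_iff, eq_top_iff]
  intro w _
  by_contra hw
  -- `K ⊔ ⟨w⟩` still misses `v`, contradicting maximality
  have hK' : v ∉ K ⊔ zmultiples w := by
    intro hvmem
    obtain ⟨y, hy, u, hu, hyu⟩ := AddSubgroup.mem_sup.mp hvmem
    have hu0 : u ≠ 0 := by
      rintro rfl
      rw [add_zero] at hyu
      exact hKv (hyu ▸ hy)
    -- `u ∈ ⟨w⟩` non-zero of prime order generates `⟨w⟩`, so `w ∈ ⟨u⟩ = ⟨v - y⟩ ≤ ⟨v⟩ ⊔ K`
    haveI : Fact p.Prime := ⟨hp⟩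
    have hw0 : w ≠ 0 := by
      rintro rfl
      rw [AddSubgroup.zmultiples_zero_eq_bot, AddSubgroup.mem_bot] at hu
      exact hu0 hu
    have hordw : addOrderOf w = p := addOrderOf_eq_prime (hCp w) hw0
    have hordu : addOrderOf u = p := addOrderOf_eq_prime (hCp u) hu0
    have heq : zmultiples u = zmultiples w := by
      refine AddSubgroup.eq_of_le_of_card_ge (AddSubgroup.zmultiples_le_of_mem hu) ?_
      rw [Nat.card_zmultiples, Nat.card_zmultiples, hordw, hordu]
    have hwu : w ∈ zmultiples u := by rw [heq]; exact AddSubgroup.mem_zmultiples w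
    have huv : u = v - y := by rw [← hyu]; abel
    apply hw
    refine (AddSubgroup.zmultiples_le_of_mem ?_) hwu
    rw [huv]
    exact AddSubgroup.sub_mem _ (AddSubgroup.mem_sup_left (AddSubgroup.mem_zmultiples v))
      (AddSubgroup.mem_sup_right hy)
  have hKeq := hKmax (K ⊔ zmultiples w) hK' le_sup_left
  apply hw
  have hwK : w ∈ K := by
    rw [← hKeq]; exact AddSubgroup.mem_sup_right (AddSubgroup.mem_zmultiples w)
  exact AddSubgroup.mem_sup_right hwK

end Threading

end Summit.BirchSwinnertonDyer.BirchSwinnertonDyer.Theorems.KolyvaginLiftGroupsTwo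

end
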